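import Summits.BirchSwinnertonDyer.BirchSwinnertonDyer.Theorems.PrintCFramBottomClassIndexLawFiveLeFlipRungTwoOfJML
import HarnessLib

/-!
# Crux `PrintCFram.BottomClassIndexLawFiveLe` (stmt-BirchSwinnertonDyer-20372), line `eisenstein-resource-bdp-line` (registry v29,
# `stub_flipRungs.2` = (FlipRungTwo⁶)): T6 piece P5-bis — (RungTwo⁶) ON `8 ∣ m` ⟸ (JMLTwoEight⁶): THE e = 3 BOOKKEEPING TWIN OF P5
# (cell `bsd-print-cfram`, width seat `bsd-line-cfram-p1-w6` g10; THEOREMS ONLY, `--supports` 20372; BSD is not proved by any of this)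

HONEST FRAMING. Nothing here is a statement about BSD; no registered stub is closed. P5 (`…FlipRungTwoOfJML`, p714682) reduced the
`4 ∥ m` half of (RungTwo⁶) (the `hRung` of w7 g8's layer A `flipRungTwo_six_of_rungTwo`, p711746) to the modular-free interface (JMLTwo⁶) and
split off the `8 ∣ m` half (RungTwo⁶)∣_{8 ∣ m} (the `hEight` binder of `rungTwo_six_of_four_of_eight`) as the residue LEAD's v30 keeps. The modular
side for `8 ∣ m` (piece P6 of the T6 notes: `m = 8m₁`, `g := G|U_8` with `ψ₂ = (2/·)`, the ONE-STEP rung (ii) «`w_c(n) ≠ 0 ⟺ n ≡ c (mod 2)`»,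
T6a `dft8_pattern_chi8/chi4chi8`; `U_2` on half-integral weight forms is not in the tree — or w7 g8's O3 road, the direct modulus-`64` cut of `G`,
which reads the SAME hypothesis set `{a(8n) : n ≡ c (8)}`) is NOT typed here. This file does for it what P5 did for `4 ∥ m`: it isolates the
ONE statement with NO modular object in it that either P6 road has to deliver — **(JMLTwoEight⁶)** (the `hJML` binder of
`rungTwoEight_six_of_jmlTwoEight`), in the WEAK FORM layer B needs: for a class datum with `8 ∣ m`, a pattern `τ`, and the coefficient function
`a = 𝟙_{AWAY₂′}·H(k, ·)` of the odd-condition cut (`AWAY₂′ i := m/8 ∣ i ∧ J(−(i/(m/8)) | q') = τ(q')·J(2 | q')` at the odd primes `q' ∣ m`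
`∧ 3 ∤ i/(m/8)` — NOTE the re-keying factor `J(2 | q')`: on the multiples of `m`, `i/(m/8) = 8·(i/m)` and `J(−8r | q') = J(2 | q')·J(−r | q')`;
for `4 ∥ m` the factor was `J(4 | q') = 1`), there is `N` (`p ∤ N`, `2 ∣ N`) such that for every ODD class `c (mod 8)`: if `a(8n) ∈ p·ℤ̄[1/N]` at
every `n ≡ c (mod 8)` then `a(8n) ∈ p·ℤ̄[1/N]` at every odd `n`. And it PROVES

* **`rungTwoEight_six_of_jmlTwoEight : (JMLTwoEight⁶) → (RungTwo⁶)∣_{8 ∣ m}`** (conclusion = P5's `hEight` binder VERBATIM, so v30 can read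
  `stub_rungTwoEight := rungTwoEight_six_of_jmlTwoEight <P6>` or register (JMLTwoEight⁶) itself as the modular-free residue): ONE step — `m = 8m₁`,
  `m₁` odd (`χ(−1)·m = 8·(χ(−1)m₁)` with `2·χ(−1)m₁` squarefree); the seed class `c_S = 7m₁` is odd; INPUT from the (RungTwo⁶) hypothesis +
  Carlitz dyadicity + w8 g9's input reading at the FULL indices `8n = m r`, `r ≡ 7 (8)`; OUTPUT at the target `8n' = m r'`, `r' ≡ 3 (8)`, `n'` odd,
  by w8 g9's output reading (weight `1`). No liveness condition arises.

* §1 `jacobiSym_neg_eight_mul` (`J(−8r | q') = J(2 | q')·J(−r | q')`), `eight_dvd_conductor_odd_quotient` (`8 ∣ m` ⟹ `m/8` odd);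
* §2 **`rungTwoEight_six_of_jmlTwoEight`**.

No definitions, no named facts, no `sorry`. beyond-print theorem: NO (bookkeeping). References: crux notes w7g8-T6 §1d(ii), §2, §5c (P6), O3;
[Cohen1975] Thm. 3.1; [Katz1973] Cor. 1.6.2 (currency only); [MontgomeryVaughan2007] Thm. 9.13.
-/

set_option autoImplicit false
-- summit-side namespace `Summit.BirchSwinnertonDyer.BirchSwinnertonDyer.…` (single-conjunct summit, D-0017 layout)
set_option linter.dupNamespace false

noncomputable section

open scoped Classical NumberTheorySymbols
open DirichletCharacter
open Literature.NumberTheory.ModularForms.CohenEisenstein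

namespace Summit.BirchSwinnertonDyer.BirchSwinnertonDyer.Theorems.PrintCFram.FlipRung

open Summit.BirchSwinnertonDyer.BirchSwinnertonDyer.Theorems.PrintCFram

/-! ## §1 Small pieces -/

/-- `J(−8r | q') = J(2 | q')·J(−r | q')` at an odd prime `q'` (`−8r = 2·(−4r)`, `J(4 | q') = 1`). [cite: IrelandRosen1990, Prop. 5.2.2] -/
theorem jacobiSym_neg_eight_mul {q' : ℕ} (hq' : q'.Prime) (hq'2 : q' ≠ 2) (r : ℕ) :
    jacobiSym (-((8 * r : ℕ) : ℤ)) q' = jacobiSym 2 q' * jacobiSym (-(r : ℕ) : ℤ) q' := by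
  have hcast : (-((8 * r : ℕ) : ℤ)) = 2 * (-((4 * r : ℕ) : ℤ)) := by push_cast; ring
  rw [hcast, jacobiSym.mul_left, jacobiSym_neg_four_mul hq' hq'2 r]

/-- **A conductor of a primitive quadratic character divisible by `8` is `8m₁` with `m₁` odd** (`χ(−1)·m = 4d'` with `d' = 2·χ(−1)m₁`
squarefree). [cite: MontgomeryVaughan2007, Thm. 9.13] -/
theorem eight_dvd_conductor_odd_quotient {p : ℕ} [Fact p.Prime] {m : ℕ} [NeZero m] {χ : DirichletCharacter ℚ_[p] m}
    (hχ : χ.IsPrimitive) (hχq : χ.IsQuadratic) (h8 : 8 ∣ m) : m / 8 % 2 = 1 := by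
  obtain ⟨s, hs1', hs⟩ := Literature.NumberTheory.LFunctions.PrimitiveQuadratic.exists_sign_eq_of_charZero χ
  have hs1 : s = 1 ∨ s = -1 := by rcases hs1' with ⟨h, -⟩ | ⟨h, -⟩ <;> simp [h]
  obtain ⟨m₁, rfl⟩ := h8
  have hdiv : 8 * m₁ / 8 = m₁ := Nat.mul_div_cancel_left _ (by norm_num)
  rw [hdiv]
  rcases CohenCut.sign_mul_eq_one_or_isFundamental hχ hχq hs hs1 with h | ⟨h, -, -⟩ | ⟨-, -, hsf⟩
  · exfalso; rcases hs1 with rfl | rfl <;> push_cast at h <;> omega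
  · exfalso; rcases hs1 with rfl | rfl <;> push_cast at h <;> omega
  · by_contra hodd
    obtain ⟨t, rfl⟩ : 2 ∣ m₁ := by omega
    have hq : (s * ((8 * (2 * t) : ℕ) : ℤ)) / 4 = 2 * 2 * (s * t) := by
      have h4 : (s * ((8 * (2 * t) : ℕ) : ℤ)) = 4 * (2 * 2 * (s * t)) := by push_cast; ring
      rw [h4, Int.mul_ediv_cancel_left _ (by norm_num)]
    rw [hq] at hsf
    have hu := hsf 2 ⟨s * t, by ring⟩
    rw [Int.isUnit_iff_natAbs_eq] at hu
    norm_num at hu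

/-! ## §2 (RungTwo⁶) on `8 ∣ m` ⟸ (JMLTwoEight⁶) -/

/-- **THE 2-ADIC RUNG IN COHEN-NUMBER CURRENCY (on `8 ∣ m`) FROM THE e = 3 JOINT MODULAR LEMMA.** See the module docstring for
(JMLTwoEight⁶) (the hypothesis `hJML`: datum binders of (RungTwo⁶) followed by `8 ∣ m`; the pattern `τ`; the odd-condition cut coefficient
function `a` keyed on `m/8` with the pattern re-keyed by `J(2 | q')`; ONE `N`; for every ODD class `c`: «`a(8n) ∈ p·ℤ̄[1/N]` on `n ≡ c (mod 8)`»
⟹ «the same at every odd `n`») and the conclusion (P5's `hEight` = (RungTwo⁶) with `8 ∣ m` inserted after `2 ∣ m`, VERBATIM). PROOF. `m = 8m₁`,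
`m₁` odd (`eight_dvd_conductor_odd_quotient`). INPUT at `c_S = 7m₁` (odd): an index `8n`, `n ≡ 7m₁ (8)`, in AWAY₂′ has `n = m₁r`, `r ≡ 7 (8)`
(cancel the odd `m₁`), `J(−r | q') = τ(q')` (cancel `J(2 | q') = ±1` in `J(−8r | q') = τ(q')J(2 | q')`), `3 ∤ r`: a FULL index of class `7`, so
`‖H(k, 8n)‖_p ≤ p⁻¹` (hypothesis), `2^j·H ∈ ℤ` (Carlitz), `a(8n) ∈ p·ℤ̄[1/N]` (input reading); off AWAY₂′ `a = 0`. The ONE step gives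
membership at every odd `n`, in particular at `n' = m₁r'` for the target FULL index `a' = m r' = 8n'`, `r' ≡ 3 (mod 8)`; there `a(8n') = H(k, a')`
and the output reading (weight `1`) gives `‖H(k, a')‖_p ≤ p⁻¹`. [cite: Cohen1975, Thm. 3.1] [cite: Katz1973, §1.6 Cor. 1.6.2] -/
theorem rungTwoEight_six_of_jmlTwoEight
    (hJML : ∀ (p : ℕ) [Fact p.Prime] (m : ℕ) [NeZero m] (χ : DirichletCharacter ℚ_[p] m) (k : ℕ),
      (p = 7 ∨ p = 11 ∨ p = 19 ∨ p = 43 ∨ p = 67 ∨ p = 163) →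
      m.Coprime p → χ.IsPrimitive → χ.IsQuadratic → (k = (p + 1) / 4 ∨ k = (3 * p - 1) / 4) →
      2 ≤ k → k ≤ p - 2 → χ (-1) * (-1) ^ k = -1 → 2 ∣ m → 8 ∣ m →
      ∀ (τ : ℕ → ℤ), (∀ q' : ℕ, q'.Prime → q' ∣ m → q' ≠ 2 → (τ q' = 1 ∨ τ q' = -1)) →
      ∀ (a : ℕ → ℚ),
        (∀ i : ℕ, (m / 8 ∣ i ∧
            (∀ q' : ℕ, q'.Prime → q' ∣ m → q' ≠ 2 →
              jacobiSym (-((i / (m / 8) : ℕ) : ℤ)) q' = τ q' * jacobiSym 2 q') ∧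
            ¬ 3 ∣ i / (m / 8)) → a i = cohenH k i) →
        (∀ i : ℕ, ¬ (m / 8 ∣ i ∧
            (∀ q' : ℕ, q'.Prime → q' ∣ m → q' ≠ 2 →
              jacobiSym (-((i / (m / 8) : ℕ) : ℤ)) q' = τ q' * jacobiSym 2 q') ∧
            ¬ 3 ∣ i / (m / 8)) → a i = 0) →
      ∃ N : ℕ, ¬ p ∣ N ∧ 2 ∣ N ∧
        ∀ c : ℕ, c % 2 = 1 →
          (∀ n : ℕ, n % 8 = c % 8 →
            ∃ y : ℂ, (∃ j : ℕ, IsIntegral ℤ ((N : ℂ) ^ j * y)) ∧ ((a (8 * n) : ℚ) : ℂ) = (p : ℂ) * y) →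
          ∀ n : ℕ, n % 2 = 1 →
            ∃ y : ℂ, (∃ j : ℕ, IsIntegral ℤ ((N : ℂ) ^ j * y)) ∧ ((a (8 * n) : ℚ) : ℂ) = (p : ℂ) * y) :
    ∀ (p : ℕ) [Fact p.Prime] (m : ℕ) [NeZero m] (χ : DirichletCharacter ℚ_[p] m) (k : ℕ),
      (p = 7 ∨ p = 11 ∨ p = 19 ∨ p = 43 ∨ p = 67 ∨ p = 163) →
      m.Coprime p → χ.IsPrimitive → χ.IsQuadratic → (k = (p + 1) / 4 ∨ k = (3 * p - 1) / 4) →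
      2 ≤ k → k ≤ p - 2 → χ (-1) * (-1) ^ k = -1 → 2 ∣ m → 8 ∣ m →
      ∀ (τ : ℕ → ℤ), (∀ q' : ℕ, q'.Prime → q' ∣ m → q' ≠ 2 → (τ q' = 1 ∨ τ q' = -1)) →
      (∀ a : ℕ, m ∣ a → a / m % 4 = 3 →
        (∀ q' : ℕ, q'.Prime → q' ∣ m → q' ≠ 2 → jacobiSym (-((a / m : ℕ) : ℤ)) q' = τ q') →
        a / m % 8 = 7 → ¬ 3 ∣ a / m → ‖((cohenH k a : ℚ) : ℚ_[p])‖ ≤ (p : ℝ)⁻¹) →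
      ∀ a : ℕ, m ∣ a → a / m % 4 = 3 →
        (∀ q' : ℕ, q'.Prime → q' ∣ m → q' ≠ 2 → jacobiSym (-((a / m : ℕ) : ℤ)) q' = τ q') →
        a / m % 8 = 3 → ¬ 3 ∣ a / m → ‖((cohenH k a : ℚ) : ℚ_[p])‖ ≤ (p : ℝ)⁻¹ := by
  intro p _ m _ χ k hp6 hmp hχ hχq hk hk2 hkp hpar h2m h8m τ hτ hcut a' hma' ha4' hJ' h83' h3'
  have hm0 : 0 < m := Nat.pos_of_ne_zero (NeZero.ne m)
  have hk1 : 1 ≤ k := by omega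
  -- `m = 8m₁`, `m₁` odd
  have hm₁odd := eight_dvd_conductor_odd_quotient hχ hχq h8m
  obtain ⟨m₁, hm⟩ := h8m
  have hmq : m / 8 = m₁ := by rw [hm, Nat.mul_div_cancel_left _ (by norm_num)]
  rw [hmq] at hm₁odd
  have hm₁0 : 0 < m₁ := by omega
  have hm1 : m ≠ 1 := by omega
  -- the coefficient function of the odd-condition cut (pattern re-keyed by `J(2 | q')`)
  set a : ℕ → ℚ := fun i =>
    if (m / 8 ∣ i ∧
        (∀ q' : ℕ, q'.Prime → q' ∣ m → q' ≠ 2 →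
          jacobiSym (-((i / (m / 8) : ℕ) : ℤ)) q' = τ q' * jacobiSym 2 q') ∧
        ¬ 3 ∣ i / (m / 8))
    then cohenH k i else 0 with hadef
  obtain ⟨N, hpN, h2N, hstep⟩ :=
    hJML p m χ k hp6 hmp hχ hχq hk hk2 hkp hpar h2m ⟨m₁, hm⟩ τ hτ a
      (fun i hi => by rw [hadef]; exact if_pos hi) (fun i hi => by rw [hadef]; exact if_neg hi)
  -- `m₁ ∣ 8n ⟹ m₁ ∣ n`
  have hcop8 : Nat.Coprime m₁ 8 := by
    rw [show (8 : ℕ) = 2 ^ 3 from rfl]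
    exact Nat.Coprime.pow_right 3 (Nat.coprime_comm.mp ((Nat.Prime.coprime_iff_not_dvd Nat.prime_two).mpr (by omega)))
  -- `J(2 | q') = ±1` at the odd primes of `m`
  have hJ2 : ∀ q' : ℕ, q'.Prime → q' ≠ 2 → (jacobiSym 2 q' = 1 ∨ jacobiSym 2 q' = -1) := by
    intro q' hq' hq'2
    haveI : NeZero q' := ⟨hq'.ne_zero⟩
    refine jacobiSym.eq_one_or_neg_one ?_
    rw [show (2 : ℤ) = ((2 : ℕ) : ℤ) from rfl, Int.gcd_natCast_natCast]
    exact (Nat.coprime_primes Nat.prime_two hq').mpr (Ne.symm hq'2)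
  -- INPUT: the seed class `c_S = 7m₁` (odd)
  have hin : ∀ n : ℕ, n % 8 = 7 * m₁ % 8 →
      ∃ y : ℂ, (∃ j : ℕ, IsIntegral ℤ ((N : ℂ) ^ j * y)) ∧ ((a (8 * n) : ℚ) : ℂ) = (p : ℂ) * y := by
    intro n hn8
    by_cases hA : (m / 8 ∣ 8 * n ∧
        (∀ q' : ℕ, q'.Prime → q' ∣ m → q' ≠ 2 →
          jacobiSym (-((8 * n / (m / 8) : ℕ) : ℤ)) q' = τ q' * jacobiSym 2 q') ∧
        ¬ 3 ∣ 8 * n / (m / 8))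
    · have ha : a (8 * n) = cohenH k (8 * n) := by rw [hadef]; exact if_pos hA
      obtain ⟨hm₁n, hJn, h3n⟩ := hA
      rw [hmq] at hm₁n hJn h3n
      have hm₁n' : m₁ ∣ n := hcop8.dvd_of_dvd_mul_left hm₁n
      obtain ⟨r, rfl⟩ := hm₁n'
      have hdiv₁ : 8 * (m₁ * r) / m₁ = 8 * r := by
        rw [show 8 * (m₁ * r) = m₁ * (8 * r) by ring, Nat.mul_div_cancel_left _ hm₁0]
      rw [hdiv₁] at hJn h3n
      have hma : m ∣ 8 * (m₁ * r) := ⟨r, by rw [hm]; ring⟩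
      have hdivm : 8 * (m₁ * r) / m = r := by
        rw [hm, show 8 * (m₁ * r) = (8 * m₁) * r by ring, Nat.mul_div_cancel_left _ (by omega)]
      have hr8 : r % 8 = 7 := by
        have h := mod_eight_eq_of_odd_mul hm₁odd (n := r) (r := 7) (by rw [hn8, mul_comm])
        simpa using h
      have hr4 : r % 4 = 3 := by omega
      have hJ : ∀ q' : ℕ, q'.Prime → q' ∣ m → q' ≠ 2 → jacobiSym (-((8 * (m₁ * r) / m : ℕ) : ℤ)) q' = τ q' := by
        intro q' hq' hq'm hq'2
        rw [hdivm]
        have h := hJn q' hq' hq'm hq'2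
        rw [jacobiSym_neg_eight_mul hq' hq'2 r] at h
        rcases hJ2 q' hq' hq'2 with h2 | h2 <;> rw [h2] at h
        · simpa using h
        · have h' := congrArg (fun x : ℤ => -x) h
          simpa using h'
      have h3 : ¬ 3 ∣ 8 * (m₁ * r) / m := by
        rw [hdivm]; exact fun h => h3n (dvd_mul_of_dvd_right h 8)
      have hnorm := hcut (8 * (m₁ * r)) hma (by rw [hdivm]; exact hr4) hJ (by rw [hdivm]; exact hr8) h3
      have h2 := exists_two_pow_mul_cohenH_eq_intCast_of_cut_sign hm1 hχ hχq hk1 hpar hτ hma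
        (by rw [hdivm]; exact hr4) hJ
      rw [ha]
      exact exists_eq_prime_mul_isIntegral_of_padicNorm_le h2N hnorm h2
    · have ha : a (8 * n) = 0 := by rw [hadef]; exact if_neg hA
      rw [ha]
      exact ⟨0, ⟨0, by simpa using isIntegral_zero⟩, by simp⟩
  -- the ONE step: class `7m₁` (odd) ↦ every odd `n`
  have h7odd : 7 * m₁ % 2 = 1 := by omega
  have hout := hstep (7 * m₁) h7odd hin
  -- the target index `a' = m r' = 8·(m₁ r')`, `r' ≡ 3 (mod 8)`
  obtain ⟨r', rfl⟩ := hma'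
  have hdiv' : m * r' / m = r' := Nat.mul_div_cancel_left _ hm0
  rw [hdiv'] at ha4' hJ' h83' h3'
  have ha'eq : m * r' = 8 * (m₁ * r') := by rw [hm]; ring
  have hdiv₁' : 8 * (m₁ * r') / m₁ = 8 * r' := by
    rw [show 8 * (m₁ * r') = m₁ * (8 * r') by ring, Nat.mul_div_cancel_left _ hm₁0]
  have hA' : (m / 8 ∣ 8 * (m₁ * r') ∧
      (∀ q' : ℕ, q'.Prime → q' ∣ m → q' ≠ 2 →
        jacobiSym (-((8 * (m₁ * r') / (m / 8) : ℕ) : ℤ)) q' = τ q' * jacobiSym 2 q') ∧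
      ¬ 3 ∣ 8 * (m₁ * r') / (m / 8)) := by
    rw [hmq, hdiv₁']
    refine ⟨⟨8 * r', by ring⟩, fun q' hq' hq'm hq'2 => ?_, fun h => h3' ?_⟩
    · rw [jacobiSym_neg_eight_mul hq' hq'2 r', hJ' q' hq' hq'm hq'2, mul_comm]
    · exact (Nat.Coprime.dvd_of_dvd_mul_left (by norm_num : Nat.Coprime 3 8) h)
  have ha : a (8 * (m₁ * r')) = cohenH k (8 * (m₁ * r')) := by rw [hadef]; exact if_pos hA'
  have hodd : m₁ * r' % 2 = 1 := by
    have hmul : m₁ * r' % 2 = (m₁ % 2) * (r' % 2) % 2 := Nat.mul_mod _ _ _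
    have hr'2 : r' % 2 = 1 := by omega
    rw [hm₁odd, hr'2] at hmul
    omega
  obtain ⟨y, hy, hxy⟩ := hout (m₁ * r') hodd
  rw [ha] at hxy
  rw [ha'eq]
  exact padicNorm_le_inv_of_mul_unit_eq_prime_mul hpN (w := 1) one_ne_zero (by simp) hy
    (by rw [mul_one]; exact hxy)

end Summit.BirchSwinnertonDyer.BirchSwinnertonDyer.Theorems.PrintCFram.FlipRung

end
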